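import Mathlib
import HarnessLib
import Literature.MathematicalPhysics.StatisticalMechanics.LinearisedMapLargePartABKM
import Literature.MathematicalPhysics.StatisticalMechanics.StepKernelBoundsABKM

/-!
# The contraction of the linearised map `C^{(q)}` and the large part of `R^{(q)}_{k+1}` for the torus
# data with a step kernel BY PREDICATE ([ABKM19] Lemmas 10.1–10.2, `q ∈ B_κ`)

`LinearisedMapABKMContraction.weakNormLE_opC_abkm`, `LinearisedMapABKMContractionGain.weakNormLE_opC_abkm_gain`
and `LinearisedMapLargePartABKM.tayNormLE_largePart_fluct_abkm` are Lemmas 10.1/10.2 for the step data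
with kernel EQUAL to the weight kernel `𝒞_{k+1}` (`q = 0`).  Of the kernel their proofs use only
`circulant ⪰ 0`, the integration property (w7′) and the smoothness of `R_{k+1}K` — the content of the
predicate `StepKernelBounds` (`StepKernelBoundsABKM`).  This file is their `q`-twin, for step data /
kernels with `StepKernelBounds W L k A𝒫' C₂ ·` relative to the `q = 0` weights (the constant `A_𝒫`
of (w7) replaced by `A𝒫'` throughout, including the side conditions `A𝒫' ≤ A`,
`2^{L^d} A𝒫' A^{−(1−1/η)} ≤ 1`):

* **`weakNormLE_opC_abkm_of_stepKernelBounds`** — Lemma 10.1+10.2: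
  `‖C^{(q)}K‖_{k+1}^{(A)} ≤ A𝒫'·abkmContrConst·‖K‖_k^{(A)}` given a closure-gain hypothesis;
* **`weakNormLE_opC_abkm_gain_of_stepKernelBounds`** — the same with the closure gain discharged;
* **`tayNormLE_largePart_fluct_abkm_of_stepKernelBounds`** — Lemma 10.2 (the large part).

The `q = 0` statements are recovered with `AbkmWeightBounds.stepKernelBounds`.  Everything is proved;
no named fact.

## References
* S. Adams, S. Buchholz, R. Kotecký, S. Müller, arXiv:1910.13564, Lemmas 10.1, 10.2, Lemma 7.7,
  Lemma 8.4 [AdamsBuchholzKoteckyMuller2019].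
-/

noncomputable section

namespace Literature.MathematicalPhysics.StatisticalMechanics.GradientRG

open scoped BigOperators Classical MatrixOrder
open Finset Matrix MeasureTheory
open Literature.MathematicalPhysics.StatisticalMechanics.GradientFRD (cExt fourierCoeff mulMat)
open Literature.MathematicalPhysics.StatisticalMechanics.TorusPolymer
  (IsPolymer blocks blockOf thicken reblock closure mem_blocks numBlocks isPolymer_blockOf
    card_blocks_eq_numBlocks boxCorner card_blockOf subset_thicken)
open Literature.Barriers.CriticalPhenomena.LongRangePhi4.Polymer (IsConn)
open Literature.MathematicalPhysics.QuantumFieldTheory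

variable {d M : ℕ} [NeZero M]

/-- **[ABKM19] Lemma 10.1 for the torus data.**  Let `d ≥ 3`, `L` odd with `L ≥ 2^{d+3} + 16R`,
`M = L^N`, `k + 1 ≤ N`, gauge order `⌊d/2⌋ + 2 ≤ p` with `p + d ≤ M_ord ≤ R`, Taylor order `r₀ ≥ 3`,
`h > 0` with `h² ≥ h₀²`, `θ̄ > 0`, `λ > 0`; let the weight tower satisfy the conclusions of Theorem 7.1
(`AbkmWeightBounds`, integration constant `A_𝒫 ≥ 0`) and let the large-set parameter satisfy
`A ≥ 1`, `A ≥ A_𝒫`, `2^{L^d} A_𝒫 A^{−(1−1/η)} ≤ 1` for a closure gain `η > 0` valid at scale `k`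
(`η|X̄|_{k+1} ≤ |X|_k` for large connected `k`-polymers; Brydges' Lemma 6.15).  Let `D` be the step
data of scale `k` (`s = L^k`, ratio `L`, kernel `𝒞_{k+1}`, reference block `B_{x₀}`, base point the
corner of `B_{x₀}*`).  Then for every translation-invariant, local, `C^{r₀}` activity `K` with `C^{r₀}`
fluctuation integrals and `‖K‖_k^{(A)} ≤ C`:
`‖C_k K‖_{k+1}^{(A)} ≤ C · (L^d · A_𝒫 · abkmContrConst d L R + ε(A))`, `ε = largePartEps d L A A_𝒫 η`.
[cite: AdamsBuchholzKoteckyMuller2019, Lemma 10.1] -/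
theorem weakNormLE_opC_abkm_of_stepKernelBounds {L N Mord R n p r₀ : ℕ} {θbar lam μ δ₁ δ₀ A𝒫 A𝒫' C₂ h A : ℝ}
    {𝒞 : ℕ → (Fin d → ZMod M) → ℝ} (hd : 3 ≤ d) (hLodd : Odd L) (hL : 2 ^ (d + 3) + 16 * R ≤ L)
    (hM : M = L ^ N) {k : ℕ} (hkN : k + 1 ≤ N) (hp : d / 2 + 2 ≤ p) (hpM : p + d ≤ Mord)
    (hMR : Mord ≤ R) (hr₀ : 3 ≤ r₀)
    (hB : AbkmWeightBounds L N Mord R n θbar lam μ δ₁ δ₀ A𝒫 𝒞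
      (abkmWeightData L N Mord R θbar (schedDelta δ₀ δ₁ N) 𝒞))
    (hδ₀ : 0 < δ₀) (hδ₁ : 0 < δ₁) (hh : 0 < h) (hh0 : hZeroSq d R δ₀ δ₁ ≤ h ^ 2)
    (hA𝒫 : 0 ≤ A𝒫') (hA : 1 ≤ A) (hA𝒫A : A𝒫' ≤ A) {η : ℝ} (hη : 0 < η)
    (hsmall : (2 : ℝ) ^ (L ^ d) * (A𝒫' * A ^ (-(1 - η⁻¹) : ℝ)) ≤ 1)
    (hgain : ∀ X : Finset (Fin d → ZMod M), IsPolymer (L ^ k) X → IsConn X →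
      2 ^ d < (blocks (L ^ k) X).card →
        η * ((blocks (L * L ^ k) (closure (L * L ^ k) X)).card : ℝ) ≤ (blocks (L ^ k) X).card)
    -- the step data of scale `k`
    (D : StepData d M) (hDs : D.s = L ^ k) (hDL : D.L = L) (hS : StepKernelBounds (abkmWeightData L N Mord R θbar (schedDelta δ₀ δ₁ N) 𝒞) L k A𝒫' C₂ D.𝒞)
    {x₀ : Fin d → ZMod M} (hB₀ : D.B₀ = blockOf (L ^ k) x₀)
    (hc₀ : D.c₀ = boxCorner (L ^ k) (starRad R L d k) x₀)
    -- the activity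
    {K : Finset (Fin d → ZMod M) → ((Fin d → ZMod M) → ℝ) → ℂ} {C : ℝ} (hC : 0 ≤ C)
    (hK : WeakNormLE (abkmNormParams L N Mord R p r₀ h θbar A (schedDelta δ₀ δ₁ N) 𝒞) k K C)
    (hKt : TransInv (L ^ k) K) (hKd : ∀ X, ContDiff ℝ r₀ (K X))
    (hKloc : ∀ X, IsPolymer (L ^ k) X → IsConn X →
      IsGaugeLocal ((abkmNormParams L N Mord R p r₀ h θbar A (schedDelta δ₀ δ₁ N) 𝒞).gauge k X) (K X))
    (hRd : ∀ X, ContDiff ℝ r₀ (fluct D.𝒞 (K X))) :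
    WeakNormLE (abkmNormParams L N Mord R p r₀ h θbar A (schedDelta δ₀ δ₁ N) 𝒞) (k + 1) (opC D K)
      (C * ((L : ℝ) ^ d * (A𝒫' * abkmContrConst d L R) + largePartEps d L A A𝒫' η)) := by
  set P := abkmNormParams L N Mord R p r₀ h θbar A (schedDelta δ₀ δ₁ N) 𝒞 with hP
  -- sizes
  have h8 : 8 ≤ 2 ^ (d + 3) := by
    calc 8 = 2 ^ 3 := by norm_num
      _ ≤ 2 ^ (d + 3) := Nat.pow_le_pow_right (by norm_num) (by omega)
  have h2dle : 2 ^ d ≤ 2 ^ (d + 3) := Nat.pow_le_pow_right (by norm_num) (by omega)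
  have hL4 : 4 ≤ L := by omega
  have hLR : 2 ^ d + R ≤ L := by omega
  have hL0 : (0 : ℝ) < L := by exact_mod_cast hLodd.pos
  have hL1 : (1 : ℝ) ≤ L := by exact_mod_cast hLodd.pos
  have hpR : p ≤ R := by omega
  have hd2 : 2 ≤ d := by omega
  -- the torus at scale `k + 1`
  obtain ⟨t, ht⟩ : ∃ t, N = (k + 1) + t := ⟨N - (k + 1), by omega⟩
  have hMt : M = P.L ^ (k + 1) * L ^ t := by
    show M = L ^ (k + 1) * L ^ t
    rw [← pow_add, ← ht]; exact hM
  have htodd : Odd (L ^ t) := hLodd.pow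
  -- the step data
  have hDs' : D.s = P.L ^ k := hDs
  have hDL' : D.L = P.L := hDL
  have hB₀' : D.B₀ = blockOf (P.L ^ k) x₀ := hB₀
  have hc₀' : D.c₀ = boxCorner (P.L ^ k) (P.rad k) x₀ := hc₀
  -- kernel facts from Theorem 7.1
  have hk1 : k + 1 ≤ N + 1 := by omega
  have hC𝒞 : (Matrix.circulant D.𝒞).PosSemidef := hS.posSemidef
  -- the gauges of the two scales
  have h𝔥k : 0 < P.𝔥 k := fieldWt_pos hh hL0 d k
  have h𝔥 : 0 < P.𝔥 (k + 1) := fieldWt_pos hh hL0 d (k + 1)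
  have hsucc : P.𝔥 (k + 1) = scaleRatio d L * P.𝔥 k := fieldWt_succ_nat hLodd.pos d k
  have hκL := scaleRatio_pos (d := d) hLodd.pos
  have hκL1 := scaleRatio_le_one hd hL4
  have h𝔥le : P.𝔥 (k + 1) ≤ P.𝔥 k := by
    rw [hsucc]; exact mul_le_of_le_one_left h𝔥k.le hκL1
  have hκ₁ : P.𝔥 (k + 1) ≤ scaleRatio d L * P.𝔥 k := hsucc.le
  have hR : 0 < P.R k := by show (0 : ℝ) < (L : ℝ) ^ k; positivity
  have hRsucc : P.R (k + 1) = P.L * P.R k := by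
    show (L : ℝ) ^ (k + 1) = (L : ℕ) * (L : ℝ) ^ k; rw [pow_succ']
  have hratio : P.𝔥 (k + 1) / P.𝔥 k * (P.R k / P.R (k + 1)) = scaleRatio d L / (P.L : ℝ) := by
    show fieldWt h (L : ℝ) d (k + 1) / fieldWt h (L : ℝ) d k * ((L : ℝ) ^ k / (L : ℝ) ^ (k + 1)) =
      scaleRatio d L / L
    rw [fieldWt_succ_nat hLodd.pos d k, pow_succ']
    exact two_scale_ratio (fieldWt_pos hh hL0 d k) (by positivity) hL0
  have hθ : P.𝔥 (k + 1) / P.𝔥 k * (P.R k / P.R (k + 1)) ≤ 1 := by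
    rw [hratio]
    show scaleRatio d L / (L : ℝ) ≤ 1
    rw [div_le_one hL0]
    exact hκL1.trans hL1
  have hp' : d / 2 + 2 ≤ P.p := hp
  have hr₀' : 3 ≤ P.r₀ := hr₀
  have hrad : P.rad k ≤ P.rad (k + 1) := starRad_le_succ hLR k
  have hrad' : P.rad k + (2 ^ d - 1) * P.L ^ k ≤ P.rad (k + 1) := starRad_add_le_succ hLR k
  -- the box `B*`
  have hbox := two_mul_box_add_le (d := d) hL hpR k
  have hside := boxSide_le (d := d) hL k
  have hLN : L ^ (k + 1) ≤ M := by rw [hM]; exact Nat.pow_le_pow_right hLodd.pos hkN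
  have hLk1 : 1 ≤ L ^ k := Nat.one_le_pow _ _ hLodd.pos
  have hdiv : 2 * ((L ^ k - 1) / 2) + 1 ≤ L ^ k := by
    have := Nat.mul_div_le (L ^ k - 1) 2; omega
  have hwrap : 4 * ((P.L ^ k - 1) / 2 + P.rad k) < M := by
    show 4 * ((L ^ k - 1) / 2 + starRad R L d k) < M
    omega
  have hroom : ((2 * ((P.L ^ k - 1) / 2 + P.rad k) : ℕ) + (P.p : ℤ)) * 2 < M := by
    show ((2 * ((L ^ k - 1) / 2 + starRad R L d k) : ℕ) + (p : ℤ)) * 2 < (M : ℤ)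
    have h2 : (2 * ((L ^ k - 1) / 2 + starRad R L d k) + p) * 2 < M := by omega
    exact_mod_cast h2
  have hC₁ : (0 : ℝ) ≤ ((2 * R + 2 : ℕ) : ℝ) := Nat.cast_nonneg _
  have hρ : ((2 * ((P.L ^ k - 1) / 2 + P.rad k) : ℕ) : ℝ) ≤ ((2 * R + 2 : ℕ) : ℝ) * P.R k := by
    show ((2 * ((L ^ k - 1) / 2 + starRad R L d k) : ℕ) : ℝ) ≤ ((2 * R + 2 : ℕ) : ℝ) * (L : ℝ) ^ k
    exact_mod_cast hside
  have hC₀ : (1 : ℝ) ≤ ((2 * R + 2 : ℕ) : ℝ) + ((d / 2 + 1 : ℕ) : ℝ) := by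
    have : (1 : ℝ) ≤ ((2 * R + 2 : ℕ) : ℝ) := by exact_mod_cast (show 1 ≤ 2 * R + 2 by omega)
    linarith [(Nat.cast_nonneg (d / 2 + 1) : (0 : ℝ) ≤ _)]
  have hρ0 : ((2 * ((P.L ^ k - 1) / 2 + P.rad k) : ℕ) : ℝ) + (d / 2 + 1 : ℕ) ≤
      (((2 * R + 2 : ℕ) : ℝ) + ((d / 2 + 1 : ℕ) : ℝ)) * P.R k := by
    have hLk : (1 : ℝ) ≤ (L : ℝ) ^ k := one_le_pow₀ hL1
    have h1 : ((d / 2 + 1 : ℕ) : ℝ) ≤ ((d / 2 + 1 : ℕ) : ℝ) * (L : ℝ) ^ k :=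
      le_mul_of_one_le_right (Nat.cast_nonneg _) hLk
    calc ((2 * ((P.L ^ k - 1) / 2 + P.rad k) : ℕ) : ℝ) + (d / 2 + 1 : ℕ)
        ≤ ((2 * R + 2 : ℕ) : ℝ) * P.R k + ((d / 2 + 1 : ℕ) : ℝ) * (L : ℝ) ^ k := add_le_add hρ h1
      _ = (((2 * R + 2 : ℕ) : ℝ) + ((d / 2 + 1 : ℕ) : ℝ)) * P.R k := by
          show ((2 * R + 2 : ℕ) : ℝ) * (L : ℝ) ^ k + _ = _ * (L : ℝ) ^ k; ring
  -- the three discharged hypothesis shapes and the weights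
  have hWd := hB.dominated
  have hWm := hB.monotone
  have hw6 : NextWeightDominates P k := nextWeightDominates_abkm hB hLodd hLR hMt htodd p r₀ h A
  have hw9 : ∀ U, IsPolymer (P.L ^ (k + 1)) U → W9At P k U := fun U hU =>
    w9At_abkm hd2 hLodd hL hM hkN hpM hB hδ₀ hδ₁ hh hh0 r₀ A hU
  have hint : IntegrationProperty P k D.𝒞 A𝒫' := by
    exact integrationProperty_of_stepKernelBounds hB hS p r₀ h A
  -- Lemma 10.1 (ray form)
  have hmain := weakNormLE_opC_of_ray P hMt hLodd htodd D hDs' hDL' hB₀' hc₀' hC𝒞 h𝔥 h𝔥le hκ₁ hR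
    hRsucc hθ hp' hr₀' hrad hrad' hwrap hroom hC₁ hρ hC₀ hρ0 hWd hWm hw6 hw9 hA𝒫 hA𝒫A hA hη hint
    hsmall hgain hC hK (by rwa [hDs]) hKd hKloc (by exact hRd)
  -- the constant is `k`-independent
  have hconst : 1536 * A𝒫' * blockContrConst d (P.𝔥 k) (P.𝔥 (k + 1)) (P.R k) (P.R (k + 1)) P.L
      (scaleRatio d L) ((2 * R + 2 : ℕ) : ℝ) (((2 * R + 2 : ℕ) : ℝ) + ((d / 2 + 1 : ℕ) : ℝ)) =
      A𝒫' * abkmContrConst d L R := by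
    rw [blockContrConst_eq_of_ratio d hratio]
    show 1536 * A𝒫' * blockContrConst d 1 (scaleRatio d L) 1 (L : ℝ) (L : ℝ) (scaleRatio d L)
        ((2 * R + 2 : ℕ) : ℝ) (((2 * R + 2 : ℕ) : ℝ) + ((d / 2 + 1 : ℕ) : ℝ)) =
      A𝒫' * (1536 * blockContrConst d 1 (scaleRatio d L) 1 (L : ℝ) (L : ℝ) (scaleRatio d L)
        ((2 * R + 2 : ℕ) : ℝ) (((2 * R + 2 : ℕ) : ℝ) + ((d / 2 + 1 : ℕ) : ℝ)))
    ring
  rw [hconst] at hmain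
  exact hmain

/-- **[ABKM19] Lemma 10.1 for the torus data, closure gain discharged**: the statement of
`weakNormLE_opC_abkm` with `η := 1 + (2(2^d+1)+6)^{−d}` and without the hypothesis `hgain` (supplied by
`closureGain_pow`, i.e. by Brydges' Lemma 6.15 proved in `PolymerClosureGainTorus`).
[cite: AdamsBuchholzKoteckyMuller2019, Lemma 10.1] -/
theorem weakNormLE_opC_abkm_gain_of_stepKernelBounds {L N Mord R n p r₀ : ℕ} {θbar lam μ δ₁ δ₀ A𝒫 A𝒫' C₂ h A : ℝ}
    {𝒞 : ℕ → (Fin d → ZMod M) → ℝ} (hd : 3 ≤ d) (hLodd : Odd L) (hL : 2 ^ (d + 3) + 16 * R ≤ L)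
    (hM : M = L ^ N) {k : ℕ} (hkN : k + 1 ≤ N) (hp : d / 2 + 2 ≤ p) (hpM : p + d ≤ Mord)
    (hMR : Mord ≤ R) (hr₀ : 3 ≤ r₀)
    (hB : AbkmWeightBounds L N Mord R n θbar lam μ δ₁ δ₀ A𝒫 𝒞
      (abkmWeightData L N Mord R θbar (schedDelta δ₀ δ₁ N) 𝒞))
    (hδ₀ : 0 < δ₀) (hδ₁ : 0 < δ₁) (hh : 0 < h) (hh0 : hZeroSq d R δ₀ δ₁ ≤ h ^ 2)
    (hA𝒫 : 0 ≤ A𝒫') (hA : 1 ≤ A) (hA𝒫A : A𝒫' ≤ A)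
    (hsmall : (2 : ℝ) ^ (L ^ d) * (A𝒫' * A ^ (-(1 - (1 + 1 / ((2 * (2 ^ d + 1) + 6 : ℝ) ^ d))⁻¹) : ℝ)) ≤ 1)
    -- the step data of scale `k`
    (D : StepData d M) (hDs : D.s = L ^ k) (hDL : D.L = L) (hS : StepKernelBounds (abkmWeightData L N Mord R θbar (schedDelta δ₀ δ₁ N) 𝒞) L k A𝒫' C₂ D.𝒞)
    {x₀ : Fin d → ZMod M} (hB₀ : D.B₀ = blockOf (L ^ k) x₀)
    (hc₀ : D.c₀ = boxCorner (L ^ k) (starRad R L d k) x₀)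
    -- the activity
    {K : Finset (Fin d → ZMod M) → ((Fin d → ZMod M) → ℝ) → ℂ} {C : ℝ} (hC : 0 ≤ C)
    (hK : WeakNormLE (abkmNormParams L N Mord R p r₀ h θbar A (schedDelta δ₀ δ₁ N) 𝒞) k K C)
    (hKt : TransInv (L ^ k) K) (hKd : ∀ X, ContDiff ℝ r₀ (K X))
    (hKloc : ∀ X, IsPolymer (L ^ k) X → IsConn X →
      IsGaugeLocal ((abkmNormParams L N Mord R p r₀ h θbar A (schedDelta δ₀ δ₁ N) 𝒞).gauge k X) (K X))
    (hRd : ∀ X, ContDiff ℝ r₀ (fluct D.𝒞 (K X))) :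
    WeakNormLE (abkmNormParams L N Mord R p r₀ h θbar A (schedDelta δ₀ δ₁ N) 𝒞) (k + 1) (opC D K)
      (C * ((L : ℝ) ^ d * (A𝒫' * abkmContrConst d L R) + largePartEps d L A A𝒫' (1 + 1 / ((2 * (2 ^ d + 1) + 6 : ℝ) ^ d))))  := by
  have h8 : 8 ≤ 2 ^ (d + 3) := by
    calc 8 = 2 ^ 3 := by norm_num
      _ ≤ 2 ^ (d + 3) := Nat.pow_le_pow_right (by norm_num) (by omega)
  have h2dle : 2 ^ d ≤ 2 ^ (d + 3) := Nat.pow_le_pow_right (by norm_num) (by omega)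
  have hL2 : 2 ^ d + 1 ≤ L := by omega
  have hL4 : 4 ≤ L := by omega
  exact weakNormLE_opC_abkm_of_stepKernelBounds hd hLodd hL hM hkN hp hpM hMR hr₀ hB hδ₀ hδ₁ hh hh0 hA𝒫 hA
    hA𝒫A (by positivity) hsmall (fun X hX hc hl => closureGain_pow hLodd hL2 hL4 hM hkN hX hc hl)
    D hDs hDL hS hB₀ hc₀ hC hK hKt hKd hKloc hRd

/-- **[ABKM19] Lemma 10.2 for the torus data** (module docstring): `d ≥ 3`, `L` odd, `L ≥ 2^{d+3}+16R`,
`M = L^N`, `k+1 ≤ N`, `θ̄, λ > 0`, `AbkmWeightBounds` (`A_𝒫 ≥ 0`), `h > 0`, `1 ≤ A`, `A_𝒫 ≤ A`,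
`2^{L^d} A_𝒫 A^{−(1−1/η(d))} ≤ 1`; `K` with `‖K‖_k^{(A)} ≤ C`, `C^{r₀}`, local on connected polymers; `U` a
non-empty `(k+1)`-polymer. [cite: AdamsBuchholzKoteckyMuller2019, Lemma 10.2] -/
theorem tayNormLE_largePart_fluct_abkm_of_stepKernelBounds {L N Mord R n p r₀ : ℕ} {θbar lam μ δ₁ δ₀ A𝒫 A𝒫' C₂ h A : ℝ}
    {𝒞 : ℕ → (Fin d → ZMod M) → ℝ} (hd : 3 ≤ d) (hLodd : Odd L) (hL : 2 ^ (d + 3) + 16 * R ≤ L)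
    (hM : M = L ^ N) {k : ℕ} (hkN : k + 1 ≤ N)
    {𝒞q : (Fin d → ZMod M) → ℝ} (hS : StepKernelBounds (abkmWeightData L N Mord R θbar (schedDelta δ₀ δ₁ N) 𝒞) L k A𝒫' C₂ 𝒞q)
    (hB : AbkmWeightBounds L N Mord R n θbar lam μ δ₁ δ₀ A𝒫 𝒞
      (abkmWeightData L N Mord R θbar (schedDelta δ₀ δ₁ N) 𝒞))
    (hh : 0 < h) (hA𝒫 : 0 ≤ A𝒫') (hA : 1 ≤ A) (hA𝒫A : A𝒫' ≤ A)
    (hsmall : (2 : ℝ) ^ (L ^ d) * (A𝒫' * A ^ (-(1 - (1 + 1 / ((2 * (2 ^ d + 1) + 6 : ℝ) ^ d))⁻¹) : ℝ)) ≤ 1)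
    {K : Finset (Fin d → ZMod M) → ((Fin d → ZMod M) → ℝ) → ℂ} {C : ℝ} (hC : 0 ≤ C)
    (hK : WeakNormLE (abkmNormParams L N Mord R p r₀ h θbar A (schedDelta δ₀ δ₁ N) 𝒞) k K C)
    (hKd : ∀ X, ContDiff ℝ r₀ (K X))
    (hKloc : ∀ X, IsPolymer (L ^ k) X → IsConn X →
      IsGaugeLocal ((abkmNormParams L N Mord R p r₀ h θbar A (schedDelta δ₀ δ₁ N) 𝒞).gauge k X) (K X))
    {U : Finset (Fin d → ZMod M)} (hU : IsPolymer (L ^ (k + 1)) U) (hUne : U.Nonempty) :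
    TayNormLE ((abkmNormParams L N Mord R p r₀ h θbar A (schedDelta δ₀ δ₁ N) 𝒞).gauge (k + 1) U) r₀
      ((abkmWeightData L N Mord R θbar (schedDelta δ₀ δ₁ N) 𝒞).weight (k + 1) U)
      (largePart (L ^ k) L (fluct 𝒞q) K U)
      (C * largePartEps d L A A𝒫' (1 + 1 / ((2 * (2 ^ d + 1) + 6 : ℝ) ^ d)) *
        (abkmNormParams L N Mord R p r₀ h θbar A (schedDelta δ₀ δ₁ N) 𝒞).aFactor (k + 1) U) := by
  set P := abkmNormParams L N Mord R p r₀ h θbar A (schedDelta δ₀ δ₁ N) 𝒞 with hP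
  -- sizes
  have h8 : 8 ≤ 2 ^ (d + 3) := by
    calc 8 = 2 ^ 3 := by norm_num
      _ ≤ 2 ^ (d + 3) := Nat.pow_le_pow_right (by norm_num) (by omega)
  have h2dle : 2 ^ d ≤ 2 ^ (d + 3) := Nat.pow_le_pow_right (by norm_num) (by omega)
  have hL4 : 4 ≤ L := by omega
  have h2dlt : 2 ^ d < 2 ^ (d + 3) := Nat.pow_lt_pow_right (by norm_num) (by omega)
  have hL2 : 2 ^ d + 1 ≤ L := by omega
  have hLR : 2 ^ d + R ≤ L := by omega
  have hL0 : (0 : ℝ) < L := by exact_mod_cast hLodd.pos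
  have hA0 : 0 < A := by linarith
  have hk1 : k + 1 ≤ N + 1 := by omega
  have hMo : Odd M := by rw [hM]; exact hLodd.pow
  -- the torus at scale `k + 1`
  obtain ⟨t, ht⟩ : ∃ t, N = (k + 1) + t := ⟨N - (k + 1), by omega⟩
  have hMt : M = P.L ^ (k + 1) * L ^ t := by
    show M = L ^ (k + 1) * L ^ t
    rw [← pow_add, ← ht]; exact hM
  have htodd : Odd (L ^ t) := hLodd.pow
  -- gauges of the two scales
  have h𝔥k : 0 < P.𝔥 k := fieldWt_pos hh hL0 d k
  have h𝔥 : 0 < P.𝔥 (k + 1) := fieldWt_pos hh hL0 d (k + 1)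
  have hsucc : P.𝔥 (k + 1) = scaleRatio d L * P.𝔥 k := fieldWt_succ_nat hLodd.pos d k
  have h𝔥le : P.𝔥 (k + 1) ≤ P.𝔥 k := by
    rw [hsucc]; exact mul_le_of_le_one_left h𝔥k.le (scaleRatio_le_one hd hL4)
  have hR : 0 < P.R k := by show (0 : ℝ) < (L : ℝ) ^ k; positivity
  have hRle : P.R k ≤ P.R (k + 1) := by
    show (L : ℝ) ^ k ≤ (L : ℝ) ^ (k + 1)
    exact pow_le_pow_right₀ (by exact_mod_cast hLodd.pos) (by omega)
  have hrad : P.rad k ≤ P.rad (k + 1) := starRad_le_succ hLR k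
  have hrad' : P.rad k + (2 ^ d - 1) * P.L ^ k ≤ P.rad (k + 1) := starRad_add_le_succ hLR k
  have hη : (0 : ℝ) < 1 + 1 / ((2 * (2 ^ d + 1) + 6 : ℝ) ^ d) := by positivity
  -- the discharged hypotheses
  have hw6 : NextWeightDominates P k := nextWeightDominates_abkm hB hLodd hLR hMt htodd p r₀ h A
  have hint : IntegrationProperty P k 𝒞q A𝒫' := integrationProperty_of_stepKernelBounds hB hS p r₀ h A
  have hgain : ∀ X : Finset (Fin d → ZMod M), IsPolymer (P.L ^ k) X → IsConn X →
      2 ^ d < (blocks (P.L ^ k) X).card →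
        (1 + 1 / ((2 * (2 ^ d + 1) + 6 : ℝ) ^ d)) *
          ((blocks (P.L * P.L ^ k) (closure (P.L * P.L ^ k) X)).card : ℝ) ≤ (blocks (P.L ^ k) X).card :=
    fun X hX hc hl => closureGain_pow hLodd hL2 hL4 hM hkN hX hc hl
  -- restrict `K` to connected `k`-polymers (the large part only reads those)
  set K' : Finset (Fin d → ZMod M) → ((Fin d → ZMod M) → ℝ) → ℂ :=
    fun X => if IsPolymer (L ^ k) X ∧ IsConn X then K X else 0 with hK'def
  have hK'eq : ∀ X, IsPolymer (L ^ k) X → IsConn X → K' X = K X := fun X hX hc => by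
    show (if IsPolymer (L ^ k) X ∧ IsConn X then K X else 0) = K X
    exact if_pos ⟨hX, hc⟩
  have hK' : WeakNormLE P k K' C := fun X hX hc => by rw [hK'eq X hX hc]; exact hK X hX hc
  have hK'd : ∀ X, ContDiff ℝ P.r₀ (K' X) := fun X => by
    by_cases hX : IsPolymer (L ^ k) X ∧ IsConn X
    · simp only [hK'def, if_pos hX]; exact hKd X
    · simp only [hK'def, if_neg hX]; exact contDiff_const
  have hK'loc : ∀ X, IsPolymer (P.L ^ k) X → IsConn X → IsGaugeLocal (P.gauge k X) (K' X) :=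
    fun X hX hc => by rw [hK'eq X hX hc]; exact hKloc X hX hc
  have hR'd : ∀ X, ContDiff ℝ P.r₀ (fluct 𝒞q (K' X)) := fun X => by
    by_cases hX : IsPolymer (L ^ k) X ∧ IsConn X
    · rw [hK'eq X hX.1 hX.2]
      exact contDiff_fluct_of_weakNormLE_of_stepKernelBounds hB hS hA0 hC hK hKd hKloc hX.1 hX.2
    · have : K' X = 0 := by simp only [hK'def, if_neg hX]
      rw [this]
      have h0 : fluct 𝒞q (0 : ((Fin d → ZMod M) → ℝ) → ℂ) = fun _ => 0 := fluct_const _ 0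
      rw [h0]; exact contDiff_const
  have hlp : largePart (L ^ k) L (fluct 𝒞q) K U = largePart (L ^ k) L (fluct 𝒞q) K' U := by
    funext φ
    unfold largePart
    refine sum_congr rfl fun X hX => ?_
    obtain ⟨hXp, hXc, -, -⟩ := mem_largePartIndex.1 hX
    rw [hK'eq X hXp hXc]
  rw [hlp]
  exact tayNormLE_largePart_fluct P hMt hLodd htodd h𝔥 h𝔥le hR hRle hrad hrad' hA hA𝒫 hA𝒫A hη hsmall hgain
    hint hw6 hC hK' hK'd hK'loc hR'd hU hUne

end Literature.MathematicalPhysics.StatisticalMechanics.GradientRG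

end
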